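import Literature.Topology.FourManifolds.Spin
import HarnessLib

/-!
# Spin manifolds: restriction to open submanifolds (discharge of `Literature.Topology.FourManifolds.IsSpin.opens`)

Sibling proof file of `Spin.lean` (D-0014: named facts `def X : Prop` are discharged as
`theorem X_holds : X`). It discharges

* `Literature.IsSpin.opens_holds : IsSpin.opens` — if `M` is spin (`Literature.IsSpin I M`: orientable, and
  `f*TM ⊕ ℝ` trivial along every map `f` of a closed surface) then so is every open submanifold
  `U : TopologicalSpace.Opens M` with its induced charted-space structure
  (`TopologicalSpace.Opens.instChartedSpace`, charts `(chartAt H x.1).subtypeRestr`).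

Source: Lawson–Michelsohn, *Spin Geometry* (1989), Ch. II §1 (Prop. 1.10 ff.): spin structures,
like orientations, restrict to open subsets since `TU = TM|_U` and `w(TU) = w(TM)|_U`. With the
surface criterion adopted as the definition of `IsSpin` in `Spin.lean` no characteristic-class
theory is needed; the whole content is the identification `TU = TM|_U`, which in Mathlib's
chart-based tangent bundle reads:

* `Literature.Topology.FourManifolds.tangentCoordChange_opens`: for `x y : U`, the tangent coordinate change of `U` from the
  chart at `x` to the chart at `y`, evaluated at `x`, equals that of `M` at `x.1`; because the
  chart-change maps of `U` and of `M` agree near `extChartAt I x x`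
  (`TopologicalSpace.Opens.chartAt_subtype_val_symm_eventuallyEq`), so their derivatives within
  `range I` coincide (`Filter.EventuallyEq.fderivWithin_eq_of_nhds`).
* `Literature.Topology.FourManifolds.IsOrientable.opens`: an orientation of `M` (a locally constant choice of orientations of the
  tangent spaces read in the preferred charts, `Literature.Topology.FourManifolds.SmoothOrientation`) restricts to `U`.
* `Literature.Topology.FourManifolds.HasStableTangentFramingAlong.of_comp_subtype_val`: for `f : S → U` continuous, a stable
  framing of `(val ∘ f)*TM ⊕ ℝ` is a stable framing of `f*TU ⊕ ℝ`: continuity of a map into the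
  total space of a fibre bundle is continuity of the projection and of the fibre coordinate in the
  local trivialisation (`FiberBundle.continuousAt_totalSpace`), and the local trivialisations of
  `TU` and `TM` have the same fibre coordinate by `tangentCoordChange_opens`.
-/

open scoped Manifold ContDiff Topology
open Set Module Bundle

noncomputable section

namespace Literature.Topology.FourManifolds

section Opens

variable {E H : Type*} [NormedAddCommGroup E] [NormedSpace ℝ E] [TopologicalSpace H]
  {I : ModelWithCorners ℝ E H} {M : Type*} [TopologicalSpace M] [ChartedSpace H M]
  [IsManifold I 1 M]

/-- The tangent coordinate changes of an open submanifold `U ⊆ M` (charts of `U` are the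
restrictions `(chartAt H x.1).subtypeRestr` of the charts of `M`) agree with those of `M` at the
base point of the first chart: the two chart-change maps coincide near `extChartAt I x x`
(`TopologicalSpace.Opens.chartAt_subtype_val_symm_eventuallyEq`), hence have the same derivative
within `range I` there (Lawson–Michelsohn, *Spin Geometry*, Ch. II §1: `TU = TM|_U`). [folklore] -/
theorem tangentCoordChange_opens (U : TopologicalSpace.Opens M) (x y : U) :
    tangentCoordChange I x y x = tangentCoordChange I (x : M) (y : M) (x : M) := by
  rw [tangentCoordChange_def, tangentCoordChange_def]
  have hpt : extChartAt I x x = extChartAt I (x : M) (x : M) := rfl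
  rw [hpt]
  apply Filter.EventuallyEq.fderivWithin_eq_of_nhds
  have h := TopologicalSpace.Opens.chartAt_subtype_val_symm_eventuallyEq (H := H) U (x := x)
  have h3 : I.symm (extChartAt I (x : M) (x : M)) = chartAt H (x : M) (x : M) := by
    simp only [extChartAt_coe, Function.comp_apply, ModelWithCorners.left_inv]
  have h4 : Filter.Tendsto I.symm (𝓝 (extChartAt I (x : M) (x : M)))
      (𝓝 (chartAt H (x : M) (x : M))) := by
    have := I.continuous_symm.continuousAt (x := extChartAt I (x : M) (x : M))
    rwa [ContinuousAt, h3] at this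
  filter_upwards [h4.eventually h] with e he
  simp only [Function.comp_apply] at he
  simp only [Function.comp_apply, extChartAt_coe, extChartAt_coe_symm]
  rw [he]
  rfl

/-- An open submanifold of an orientable manifold is orientable: a smooth orientation `o` of `M`
restricts to `U` as `x ↦ o x.1`; local constancy transfers because the tangent coordinate changes
of `U` are those of `M` (`tangentCoordChange_opens`) (Hirsch, *Differential Topology*, §4.4;
Lawson–Michelsohn, *Spin Geometry*, Ch. II §1). [folklore] -/
theorem IsOrientable.opens (h : IsOrientable I M) (U : TopologicalSpace.Opens M) :
    IsOrientable I U := by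
  obtain ⟨o⟩ := h
  refine ⟨{ toFun := fun x ↦ o (x : M), eventually_eq_iff' := fun x ↦ ?_ }⟩
  have hc : ContinuousAt (Subtype.val : U → M) x := continuous_subtype_val.continuousAt
  filter_upwards [hc.tendsto.eventually (o.eventually_eq_iff (x : M))] with y hy
  rw [tangentCoordChange_opens]
  exact hy

/-- Stable framings along maps into an open submanifold `U ⊆ M`: a stable framing of
`(val ∘ f)*TM ⊕ ℝ` *is* a stable framing of `f*TU ⊕ ℝ`, since `T_x U = T_x M` and the local
trivialisations of `TU` are those of `TM` (`tangentCoordChange_opens`), so continuity into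
`TangentBundle I U` and into `TangentBundle I M` agree (`FiberBundle.continuousAt_totalSpace`)
(Milnor–Stasheff, *Characteristic Classes*, §3; Lawson–Michelsohn, *Spin Geometry*, Ch. II §1).
[folklore] -/
theorem HasStableTangentFramingAlong.of_comp_subtype_val {S : Type*} [TopologicalSpace S]
    (U : TopologicalSpace.Opens M) {f : S → U} (hf : Continuous f)
    (h : HasStableTangentFramingAlong I M (Subtype.val ∘ f)) :
    HasStableTangentFramingAlong I U f := by
  obtain ⟨s, hs, hs', hli⟩ := h
  refine ⟨s, fun i ↦ ?_, hs', hli⟩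
  rw [continuous_iff_continuousAt]
  intro p
  have := (hs i).continuousAt (x := p)
  rw [FiberBundle.continuousAt_totalSpace] at this ⊢
  refine ⟨hf.continuousAt, ?_⟩
  have key : (fun q ↦ ((trivializationAt E (TangentSpace I) (f p))
        (TotalSpace.mk' E (f q) (s i q).1 : TangentBundle I U)).2) =
      fun q ↦ ((trivializationAt E (TangentSpace I) ((f p : U) : M))
        (TotalSpace.mk' E ((f q : U) : M) (s i q).1 : TangentBundle I M)).2 := by
    funext q
    change tangentCoordChange I (f q) (f p) (f q) (s i q).1 =
      tangentCoordChange I ((f q : U) : M) ((f p : U) : M) ((f q : U) : M) (s i q).1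
    rw [tangentCoordChange_opens]
  rw [key]
  exact this.2

/-- **Discharge of `Literature.Topology.FourManifolds.IsSpin.opens`.** Being spin restricts to open submanifolds: the
orientation restricts (`IsOrientable.opens`), and for a surface map `f : S → U` the stable framing
of `(val ∘ f)*TM ⊕ ℝ` provided by `IsSpin I M` is a stable framing of `f*TU ⊕ ℝ`
(`HasStableTangentFramingAlong.of_comp_subtype_val`), because the charts of `U` are restrictions
of charts of `M` (Lawson–Michelsohn, *Spin Geometry* (1989), Ch. II §1, Prop. 1.10 ff.:
`w(TU) = w(TM)|_U`). [cite: LawsonMichelsohn1989, Ch. II Prop. 1.10 ff.] -/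
theorem IsSpin.opens_holds : IsSpin.opens (I := I) (M := M) := by
  intro U h
  refine ⟨h.1.opens U, fun S _ _ _ _ _ f ↦ ?_⟩
  exact HasStableTangentFramingAlong.of_comp_subtype_val U f.continuous
    (h.2 S ((⟨Subtype.val, continuous_subtype_val⟩ : C(U, M)).comp f))

end Opens

end Literature.Topology.FourManifolds
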